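import Summits.CriticalPhenomena.PercolationContinuityZ3.Theorems.PercNearOneGluingNoHeavyLowerTailSunflowerGraphMarkProperWindowP2
import Summits.CriticalPhenomena.PercolationContinuityZ3.Theorems.PercNearOneGluingNoHeavyLowerTailSunflowerGraphMarkProperWindowP3
import Summits.CriticalPhenomena.PercolationContinuityZ3.Theorems.PercNearOneGluingNoHeavyLowerTailSunflowerGraphMarkProperWindowP23
import Summits.CriticalPhenomena.PercolationContinuityZ3.Theorems.PercNearOneGluingNoHeavyLowerTailSunflowerWin2K4Edge
import HarnessLib

/-!
# `NoHeavyLowerTail` (crux stmt-CriticalPhenomena-4575), abstract sunflower cubic: ★ = `PartitionLemmaH` FOR EVERY PROPERLY 3-EDGE-COLOURED GRAPH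
# WITH ARBITRARY COLOUR MARKS (no degree hypothesis: a proper 3-edge-colouring has maximum degree ≤ 3; all class-1 graphs of maximum degree ≤ 3)

Support file (seat `prim-ineq-gen-2` gen 26; `--supports stmt-CriticalPhenomena-4575`).  No `sorry`; nothing is asserted about the crux.
Memo: run/shared/lean/prim/prim-ineq-gen-2/GRAPHMARK-LEAN-GEN26.md §3–§4 (certificate-level theorem of TWO-POINT-GEN25 §8b, now in the kernel).

THEOREM (`Sunflower.ZH_nonneg_of_isGraphMarkOn_proper`, `ZH_graphMarkSunflower_nonneg_of_proper`): for every PROPER 3-edge-colouring `c` of a graph on a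
finite set and all colour marks `T`, every graph-mark sunflower (`lab U = θ(colours of the edges inside U ∪ marks inside U)`) has `0 ≤ ZH`.

PROOF (strong induction on `#W` over all colourings, marks, sunflowers and sub-cubes, `ZP_nonneg_of_isGraphMarkOn_proper'`).  A marked point is a good
coordinate (`marked_step`); otherwise, if some point `q` has two NON-ADJACENT neighbours `p, r`, recolour their edges to `0, 1` (`exists_recolouring`,
`IsGraphMarkOn.ZP_eq_of_recolour`) and apply the window step (`properWindow_step`: `p` or `r` pendant, or one of the EIGHTEEN generated structured
three-point certificates `Win3P?Q?R?` according to the colours present at `p`, `q`, `r` — `properWindow_P2/P3/P23`); otherwise every point's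
neighbourhood is a clique, so the component of any point `v` is `K₁` or `K₂` (`pendant_step`), a rainbow `K₃` (`triangle_step`) or `K₄` (the structured
two-point certificate `Win2K4Edge`: `3·Z(W∖p) + 3·Z(W∖q) ≤ 4·Z(W)` at an edge of `K₄`, `k4_step`).
-/

namespace Summit.CriticalPhenomena.PercolationContinuityZ3.Theorems.SunflowerPartition

open Finset

variable {α : Type*} [Fintype α] [DecidableEq α]

namespace Sunflower

variable {F : Sunflower α} {c : α → α → Option (Fin 3)} {T : α → Finset (Fin 3)} {W : Finset α}

section Steps

variable (hc : IsProperEdgeColouring c) (hF : F.IsGraphMarkOn c T W)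
  (hIH : ∀ (F' : Sunflower α) (T' : α → Finset (Fin 3)) (W' : Finset α), #W' < #W → F'.IsGraphMarkOn c T' W' → 0 ≤ F'.ZP W' ∅ ∅ ∅)
include hc hF hIH

/-- **Window step** for proper colourings: an unmarked point `q` with two non-adjacent neighbours `p` (colour `0`) and `r` (colour `1`). [this work] -/
theorem properWindow_step (hT : ∀ x ∈ W, T x = ∅) {q p r : α} (hq : q ∈ W) (hp : p ∈ W) (hr : r ∈ W)
    (h0 : c q p = some 0) (h1 : c q r = some 1) (hpr : c p r = none) : 0 ≤ F.ZP W ∅ ∅ ∅ := by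
  have hpq0 : c p q = some 0 := by rw [hc.symm]; exact h0
  by_cases hu1 : ∃ y ∈ W, c p y = some 1 <;> by_cases hu2 : ∃ y ∈ W, c p y = some 2
  · obtain ⟨u₁, hu₁W, hu₁⟩ := hu1
    obtain ⟨u₂, hu₂W, hu₂⟩ := hu2
    exact properWindow_P23 hc hF hIH hT hq hp hr h0 h1 hpr hu₁W hu₁ hu₂W hu₂ fun y _ k hk => by
      rcases fin3_cases k with rfl | rfl | rfl
      · exact Or.inl (hc.proper p y q 0 hk hpq0)
      · exact Or.inr (Or.inl (hc.proper p y u₁ 1 hk hu₁))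
      · exact Or.inr (Or.inr (hc.proper p y u₂ 2 hk hu₂))
  · obtain ⟨u, huW, hu⟩ := hu1
    exact properWindow_P2 hc hF hIH hT hq hp hr h0 h1 hpr huW hu fun y hy k hk => by
      rcases fin3_cases k with rfl | rfl | rfl
      · exact Or.inl (hc.proper p y q 0 hk hpq0)
      · exact Or.inr (hc.proper p y u 1 hk hu)
      · exact (hu2 ⟨y, hy, hk⟩).elim
  · obtain ⟨u, huW, hu⟩ := hu2
    exact properWindow_P3 hc hF hIH hT hq hp hr h0 h1 hpr huW hu fun y hy k hk => by
      rcases fin3_cases k with rfl | rfl | rfl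
      · exact Or.inl (hc.proper p y q 0 hk hpq0)
      · exact (hu1 ⟨y, hy, hk⟩).elim
      · exact Or.inr (hc.proper p y u 2 hk hu)
  · exact pendant_step hc hF hIH hp (hT p hp) q fun y hy hyq => by
      by_contra hne
      obtain ⟨k, hk⟩ := Option.ne_none_iff_exists'.1 hne
      rcases fin3_cases k with rfl | rfl | rfl
      · exact hyq (hc.proper p y q 0 hk hpq0)
      · exact hu1 ⟨y, hy, hk⟩
      · exact hu2 ⟨y, hy, hk⟩

omit [Fintype α] in
/-- **`K₄` step**: an edge `p q` (colour `0`) whose endpoints have two further common neighbours `t₁, t₂` with crossing colours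
(`p t₁ = 1`, `p t₂ = 2`, `q t₁ = 2`, `q t₂ = 1`), `p, q` unmarked — the structured two-point certificate `Win2K4Edge`. [this work] -/
theorem k4_step (hT : ∀ x ∈ W, T x = ∅) {p q t₁ t₂ : α} (hp : p ∈ W) (hq : q ∈ W) (ht₁ : t₁ ∈ W) (ht₂ : t₂ ∈ W)
    (h0 : c p q = some 0) (hp1 : c p t₁ = some 1) (hp2 : c p t₂ = some 2) (hq1 : c q t₁ = some 2) (hq2 : c q t₂ = some 1) :
    0 ≤ F.ZP W ∅ ∅ ∅ := by
  have hs := hc.symm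
  have hi := hc.irrefl
  have hpq : p ≠ q := hc.ne_of_some h0
  have hqp0 : c q p = some 0 := by rw [hs]; exact h0
  have h12 : t₁ ≠ t₂ := ne_of_col_ne hp1 hp2 (by decide)
  set W' : Finset α := (W.erase p).erase q with hW'
  have hq1' : q ∈ W.erase p := mem_erase.2 ⟨hpq.symm, hq⟩
  have hWeq : insert p (insert q W') = W := by rw [hW', insert_erase hq1', insert_erase hp]
  have hmem : ∀ x, x ∈ W' ↔ x ≠ q ∧ x ≠ p ∧ x ∈ W := fun x => by rw [hW', mem_erase, mem_erase]
  have hW'W : W' ⊆ W := fun x hx => ((hmem x).1 hx).2.2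
  have hpW' : p ∉ W' := fun h => ((hmem p).1 h).2.1 rfl
  have hqW' : q ∉ W' := fun h => ((hmem q).1 h).1 rfl
  have ht₁W' : t₁ ∈ W' := (hmem t₁).2 ⟨ne_of_col_ne hp1 h0 (by decide), (hc.ne_of_some hp1).symm, ht₁⟩
  have ht₂W' : t₂ ∈ W' := (hmem t₂).2 ⟨ne_of_col_ne hp2 h0 (by decide), (hc.ne_of_some hp2).symm, ht₂⟩
  have hcard : #W' + 2 = #W := by
    have h2 : #({p, q} : Finset α) = 2 := card_pair hpq
    have h2le : #({p, q} : Finset α) ≤ #W := card_le_card (insert_subset hp (singleton_subset_iff.2 hq))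
    rw [hW', card_erase_of_mem hq1', card_erase_of_mem hp]
    omega
  have hXW : ∀ X ⊆ W', X ⊆ W := fun X hX => hX.trans hW'W
  have nbp : ∀ X ⊆ W', nb c p X = (if t₁ ∈ X then {1} else ∅) ∪ (if t₂ ∈ X then {2} else ∅) := fun X hX =>
    nb_eq_ite₂ h12 hp1 hp2 fun y hy hy1 hy2 => by
      by_contra hne
      obtain ⟨k, hk⟩ := Option.ne_none_iff_exists'.1 hne
      rcases fin3_cases k with rfl | rfl | rfl
      · exact hqW' ((hc.proper p y q 0 hk h0) ▸ hX hy)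
      · exact hy1 (hc.proper p y t₁ 1 hk hp1)
      · exact hy2 (hc.proper p y t₂ 2 hk hp2)
  have nbq : ∀ X ⊆ W', nb c q X = (if t₁ ∈ X then {2} else ∅) ∪ (if t₂ ∈ X then {1} else ∅) := fun X hX =>
    nb_eq_ite₂ h12 hq1 hq2 fun y hy hy1 hy2 => by
      by_contra hne
      obtain ⟨k, hk⟩ := Option.ne_none_iff_exists'.1 hne
      rcases fin3_cases k with rfl | rfl | rfl
      · exact hpW' ((hc.proper q y p 0 hk hqp0) ▸ hX hy)
      · exact hy2 (hc.proper q y t₂ 1 hk hq2)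
      · exact hy1 (hc.proper q y t₁ 2 hk hq1)
  have g1 : ∀ X ⊆ W', F.lab (insert p X) = joinM (F.lab X) (theta ((if t₁ ∈ X then {1} else ∅) ∪ (if t₂ ∈ X then {2} else ∅))) :=
    fun X hX => by rw [hF.lab_insert hs hi hp (hT p hp) (hXW X hX), nbp X hX]
  have g2 : ∀ X ⊆ W', F.lab (insert q X) = joinM (F.lab X) (theta ((if t₁ ∈ X then {2} else ∅) ∪ (if t₂ ∈ X then {1} else ∅))) :=
    fun X hX => by rw [hF.lab_insert hs hi hq (hT q hq) (hXW X hX), nbq X hX]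
  have g3 : ∀ X ⊆ W', F.lab (insert p (insert q X)) = joinM (F.lab X)
      (theta ({0} ∪ (((if t₁ ∈ X then {1} else ∅) ∪ (if t₂ ∈ X then {2} else ∅)) ∪ ((if t₁ ∈ X then {2} else ∅) ∪ (if t₂ ∈ X then {1} else ∅))))) :=
    fun X hX => by rw [hF.lab_insert₂ hs hi hp hq (hT p hp) (hT q hq) (hXW X hX), h0, Option.toFinset_some, nbp X hX, nbq X hX]
  have hb := F.wK4_edge W' hpq hpW' hqW' ht₁W' ht₂W' g1 g2 g3
  rw [hWeq] at hb
  have m1 := hIH F T (insert q W') (by rw [card_insert_of_notMem hqW']; omega) (hF.mono (insert_subset hq hW'W))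
  have m2 := hIH F T (insert p W') (by rw [card_insert_of_notMem hpW']; omega) (hF.mono (insert_subset hp hW'W))
  linarith

end Steps

/-! ## The induction and the theorem -/

/-- **★ on every sub-cube for graph-mark sunflowers of PROPER 3-edge-colourings** (strong induction on `#W`). [this work] -/
theorem ZP_nonneg_of_isGraphMarkOn_proper' : ∀ (n : ℕ) {c : α → α → Option (Fin 3)}, IsProperEdgeColouring c →
    ∀ (F : Sunflower α) (T : α → Finset (Fin 3)) (W : Finset α), #W = n → F.IsGraphMarkOn c T W → 0 ≤ F.ZP W ∅ ∅ ∅ := by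
  intro n
  induction n using Nat.strong_induction_on with
  | _ n ih =>
  intro c hc F T W hWn hF
  have hIH : ∀ (F' : Sunflower α) (T' : α → Finset (Fin 3)) (W' : Finset α), #W' < #W → F'.IsGraphMarkOn c T' W' →
      0 ≤ F'.ZP W' ∅ ∅ ∅ := fun F' T' W' hlt hF' => ih #W' (hWn ▸ hlt) hc F' T' W' rfl hF'
  rcases W.eq_empty_or_nonempty with hE | hne
  · rw [hE, F.ZP_empty]
  by_cases hmark : ∃ v ∈ W, T v ≠ ∅
  · obtain ⟨v, hv, hTv⟩ := hmark
    exact marked_step hc hF hIH hv hTv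
  push Not at hmark
  -- recolouring so that two given distinct colours `a`, `b` become `0`, `1`
  have recol : ∀ a b : Fin 3, a ≠ b → ∃ g : Fin 3 → Fin 3, Function.Injective g ∧ g a = 0 ∧ g b = 1 ∧
      IsProperEdgeColouring (fun x y => (c x y).map g) ∧
      (graphMarkSunflower (fun x y => (c x y).map g) (fun x => (T x).image g)).IsGraphMarkOn (fun x y => (c x y).map g)
        (fun x => (T x).image g) W ∧
      F.ZP W ∅ ∅ ∅ = (graphMarkSunflower (fun x y => (c x y).map g) (fun x => (T x).image g)).ZP W ∅ ∅ ∅ ∧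
      (∀ (F' : Sunflower α) (T' : α → Finset (Fin 3)) (W' : Finset α), #W' < #W →
        F'.IsGraphMarkOn (fun x y => (c x y).map g) T' W' → 0 ≤ F'.ZP W' ∅ ∅ ∅) ∧
      (∀ x ∈ W, (fun x => (T x).image g) x = ∅) := by
    intro a b hab
    obtain ⟨g, hg, hga, hgb⟩ := exists_recolouring a b hab
    have hG := graphMarkSunflower_isGraphMarkOn (fun x y => (c x y).map g) (fun x => (T x).image g) W
    exact ⟨g, hg, hga, hgb, hc.recolour hg, hG, hF.ZP_eq_of_recolour hg hG,
      fun F' T' W' hlt hF' => ih #W' (hWn ▸ hlt) (hc.recolour hg) F' T' W' rfl hF',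
      fun x hx => by simp only [hmark x hx, image_empty]⟩
  -- is there a window anywhere?
  by_cases hwin : ∃ q ∈ W, ∃ p ∈ W, ∃ r ∈ W, p ≠ r ∧ c q p ≠ none ∧ c q r ≠ none ∧ c p r = none
  · obtain ⟨q, hq, p, hp, r, hr, hpr, hcp, hcr, hprn⟩ := hwin
    obtain ⟨a, ha⟩ := Option.ne_none_iff_exists'.1 hcp
    obtain ⟨b, hb⟩ := Option.ne_none_iff_exists'.1 hcr
    have hab : a ≠ b := by
      intro h
      rw [h] at ha
      exact hpr (hc.proper q p r b ha hb)
    obtain ⟨g, _, hga, hgb, hc', hG, hZ, hIH', hT'⟩ := recol a b hab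
    rw [hZ]
    refine properWindow_step hc' hG hIH' hT' hq hp hr ?_ ?_ ?_
    · show (c q p).map g = some 0
      rw [ha, Option.map_some, hga]
    · show (c q r).map g = some 1
      rw [hb, Option.map_some, hgb]
    · show (c p r).map g = none
      rw [hprn, Option.map_none]
  -- no window: the neighbourhood of every point is a clique
  push Not at hwin
  obtain ⟨v, hv⟩ := hne
  by_cases hN0 : ∀ y ∈ W, y ≠ v → c v y = none
  · exact pendant_step hc hF hIH hv (hmark v hv) v hN0
  push Not at hN0
  obtain ⟨p, hp, -, hcp⟩ := hN0
  by_cases hN1 : ∀ y ∈ W, y ≠ p → c v y = none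
  · exact pendant_step hc hF hIH hv (hmark v hv) p hN1
  push Not at hN1
  obtain ⟨r, hr, hrp, hcr⟩ := hN1
  obtain ⟨a, ha⟩ := Option.ne_none_iff_exists'.1 hcp
  obtain ⟨b, hb⟩ := Option.ne_none_iff_exists'.1 hcr
  have hvp : v ≠ p := hc.ne_of_some ha
  have hvr : v ≠ r := hc.ne_of_some hb
  have hab : a ≠ b := by
    intro h
    rw [h] at ha
    exact hrp (hc.proper v r p b hb ha)
  have hcpr : c p r ≠ none := hwin v hv p hp r hr hrp.symm hcp hcr
  obtain ⟨e, he⟩ := Option.ne_none_iff_exists'.1 hcpr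
  have hpv : c p v = some a := by rw [hc.symm]; exact ha
  have hrv : c r v = some b := by rw [hc.symm]; exact hb
  have hrpe : c r p = some e := by rw [hc.symm]; exact he
  have hea : e ≠ a := fun h => hvr.symm (hc.proper p r v a (h ▸ he) hpv)
  have heb : e ≠ b := fun h => hvp.symm (hc.proper r p v b (h ▸ hrpe) hrv)
  obtain ⟨g, hg, hga, hgb, hc', hG, hZ, hIH', hT'⟩ := recol a b hab
  have hge : g e = 2 := by
    rcases fin3_cases (g e) with h | h | h
    · exact absurd (hg (h.trans hga.symm)) hea
    · exact absurd (hg (h.trans hgb.symm)) heb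
    · exact h
  rw [hZ]
  by_cases hN2 : ∀ y ∈ W, y ≠ p → y ≠ r → c v y = none
  · -- `v` has exactly the neighbours `p ∼ r`: if `p` or `r` had a further neighbour there would be a window; so the component is a rainbow `K₃`
    have hPx : ∀ u ∈ W, u ≠ v → u ≠ r → c p u = none := by
      intro u hu huv hur
      by_contra hcu
      obtain ⟨k, hk⟩ := Option.ne_none_iff_exists'.1 hcu
      have hup : u ≠ p := (hc.ne_of_some hk).symm
      have h1 : c v u ≠ none := hwin p hp v hv u hu huv.symm (by rw [hpv]; exact Option.some_ne_none a) hcu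
      exact h1 (hN2 u hu hup hur)
    have hRx : ∀ u ∈ W, u ≠ v → u ≠ p → c r u = none := by
      intro u hu huv hup
      by_contra hcu
      obtain ⟨k, hk⟩ := Option.ne_none_iff_exists'.1 hcu
      have hur : u ≠ r := (hc.ne_of_some hk).symm
      have h1 : c v u ≠ none := hwin r hr v hv u hu huv.symm (by rw [hrv]; exact Option.some_ne_none b) hcu
      exact h1 (hN2 u hu hup hur)
    refine triangle_step hc' hG hIH' (t := r) hv hp (hT' v hv) (hT' p hp) ?_ ?_ ?_ ?_ ?_
    · show (c v p).map g = some 0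
      rw [ha, Option.map_some, hga]
    · show (c v r).map g = some 1
      rw [hb, Option.map_some, hgb]
    · show (c p r).map g = some 2
      rw [he, Option.map_some, hge]
    · intro y hy hyp hyr
      show (c v y).map g = none
      rw [hN2 y hy hyp hyr, Option.map_none]
    · intro y hy hyv hyr
      show (c p y).map g = none
      rw [hPx y hy hyv hyr, Option.map_none]
  · -- a third neighbour `z`: the component is `K₄`; use the edge `v p` with `t₁ = r`, `t₂ = z`
    push Not at hN2
    obtain ⟨z, hz, hzp, hzr, hcz⟩ := hN2
    obtain ⟨f, hf⟩ := Option.ne_none_iff_exists'.1 hcz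
    have hvz : v ≠ z := hc.ne_of_some hf
    have hcpz : c p z ≠ none := hwin v hv p hp z hz hzp.symm hcp hcz
    obtain ⟨e', he'⟩ := Option.ne_none_iff_exists'.1 hcpz
    have hzv : c z v = some f := by rw [hc.symm]; exact hf
    have hzp' : c z p = some e' := by rw [hc.symm]; exact he'
    have hfa : f ≠ a := fun h => hzp (hc.proper v z p a (h ▸ hf) ha)
    have hfb : f ≠ b := fun h => hzr (hc.proper v z r b (h ▸ hf) hb)
    have hgf : g f = 2 := by
      rcases fin3_cases (g f) with h | h | h
      · exact absurd (hg (h.trans hga.symm)) hfa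
      · exact absurd (hg (h.trans hgb.symm)) hfb
      · exact h
    have he'a : e' ≠ a := fun h => hvz.symm (hc.proper p z v a (h ▸ he') hpv)
    have he'f : e' ≠ f := fun h => hvp.symm (hc.proper z p v f (h ▸ hzp') hzv)
    have hge' : g e' = 1 := by
      rcases fin3_cases (g e') with h | h | h
      · exact absurd (hg (h.trans hga.symm)) he'a
      · exact h
      · exact absurd (hg (h.trans hgf.symm)) he'f
    refine k4_step hc' hG hIH' hT' hv hp hr hz ?_ ?_ ?_ ?_ ?_
    · show (c v p).map g = some 0
      rw [ha, Option.map_some, hga]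
    · show (c v r).map g = some 1
      rw [hb, Option.map_some, hgb]
    · show (c v z).map g = some 2
      rw [hf, Option.map_some, hgf]
    · show (c p r).map g = some 2
      rw [he, Option.map_some, hge]
    · show (c p z).map g = some 1
      rw [he', Option.map_some, hge']

/-- **THEOREM: ★ = `PartitionLemmaH` for every graph-mark sunflower of a PROPER 3-edge-colouring with arbitrary colour marks** (no degree
hypothesis). [this work] -/
theorem ZH_nonneg_of_isGraphMarkOn_proper (hc : IsProperEdgeColouring c) (hF : F.IsGraphMarkOn c T univ) : 0 ≤ F.ZH := by
  rw [← F.ZP_univ_empty]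
  exact ZP_nonneg_of_isGraphMarkOn_proper' _ hc F T univ rfl hF

end Sunflower

/-- **COROLLARY (the concrete family)**: for every proper 3-edge-colouring `c` of a graph on a finite set and all colour marks `T`, the sunflower
`U ↦ θ(colours of the edges inside U ∪ marks inside U)` satisfies `0 ≤ ZH` — in particular for every class-1 graph of maximum degree `≤ 3`
(all class-1 cubic graphs) with any proper colouring. [this work] -/
theorem ZH_graphMarkSunflower_nonneg_of_proper (c : α → α → Option (Fin 3)) (T : α → Finset (Fin 3))
    (hc : IsProperEdgeColouring c) : 0 ≤ (graphMarkSunflower c T).ZH :=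
  Sunflower.ZH_nonneg_of_isGraphMarkOn_proper hc (graphMarkSunflower_isGraphMarkOn c T univ)

end Summit.CriticalPhenomena.PercolationContinuityZ3.Theorems.SunflowerPartition
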